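import Literature.Analysis.FluidPDE.PeriodicBoundedMildMean
import Literature.Analysis.FluidPDE.NSBoundedMildOseen
import HarnessLib

/-!
# Periodic Oseen-mild identities: the Duhamel term of a pair of periodic fields has zero average,
  and the KNSS constant of a mean-preserving identity vanishes

Analysis/FluidPDE support file (everything proved) for the perturbation step of M. P. Coiculescu,
S. Palasek, *Non-uniqueness of smooth solutions of the Navier–Stokes equations from critical data*,
Invent. Math. 244 (2025) = arXiv:2503.14699, §5 ¶1 (hypothesis `hB` of
`Literature.Barriers.NavierStokesRegularity.CriticalDataSmoothNonuniqueness_of_principalParts_of_perturbationThreshold`),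
second half of the bridge "classical with force ⇒ Oseen form" for PERIODIC fields: the a.e.
identity up to a constant `c` of `ForcedOseenMildUpToConst.lean` (KNSS 2009, Lemma 3.1 /
Rem. 3.1: the drift `b(t)`) is upgraded, for continuous periodic slices with matching averages,
to an EVERYWHERE identity with `c = 0` — the argument of `PeriodicBoundedMildTorus.lean`
("the mild formula preserves the mean, so `c ≡ 0`"):

* `Torus.integral_oseenDuhamel_pair_repr_eq_zero` — `∫_{𝕋ᵈ} B^ν_s(u, v)(t)(repr x) dx = 0` for
  bounded jointly measurable `u, v` whose slices are lifts of continuous torus fields (the tree's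
  `Torus.integral_oseenDuhamel_repr_eq_zero` for a general pair);
* `Torus.oseenMild_const_eq_zero_of_integral_eq` — if
  `lift W = e^{νtΔ}(lift U) - B^ν_0(u,u)(t) - Σᵢ B^ν_0(aᵢ,bᵢ)(t) - c` a.e. with `∫ W = ∫ U`, all
  slices lifts of continuous torus fields, then `c = 0` and the identity holds everywhere.

## References

* G. Koch, N. Nadirashvili, G. Seregin, V. Šverák, Acta Math. 203 (2009) = arXiv:0709.3599, §3
  p. 6 (Lemma 3.1, Rem. 3.1), §4 p. 8. [`KochNadirashviliSereginSverak2009`]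
* M. P. Coiculescu, S. Palasek, Invent. Math. 244 (2025) = arXiv:2503.14699, §5 ¶1.
  [`CoiculescuPalasek2025`]
-/

noncomputable section

open MeasureTheory Set Function Filter TopologicalSpace InnerProductSpace Metric
open Literature.Analysis.FunctionSpaces
open _root_.Topology
open scoped RealInnerProductSpace NNReal ENNReal

namespace Literature.Analysis.FluidPDE

namespace Torus

variable {d : Type*} [Fintype d]

/-- **The Duhamel term of a pair of periodic fields has zero average** (the tree's
`Torus.integral_oseenDuhamel_repr_eq_zero` for two different fields): for `u, v` jointly
measurable with `‖u‖, ‖v‖ ≤ M` on `(s,t) × ℝᵈ` whose slices are lifts of continuous torus fields,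
`∫_{𝕋ᵈ} B^ν_s(u, v)(t)(repr x) dx = 0` (Fubini in `(x, σ)` and
`integral_oseenSlice_lift_repr_eq_zero` slice by slice). [cite: KochNadirashviliSereginSverak2009, §3 p. 6 and §4 p. 8 (arXiv:0709.3599v1)] -/
theorem integral_oseenDuhamel_pair_repr_eq_zero
    {u v : ℝ → EuclideanSpace ℝ d → EuclideanSpace ℝ d}
    {U V : ℝ → UnitAddTorus d → EuclideanSpace ℝ d} {s t M ν : ℝ} (hν : 0 < ν)
    (hum : Measurable (uncurry u)) (hvm : Measurable (uncurry v))
    (huM : ∀ σ ∈ Ioo s t, ∀ y, ‖u σ y‖ ≤ M) (hvM : ∀ σ ∈ Ioo s t, ∀ y, ‖v σ y‖ ≤ M)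
    (hU : ∀ σ ∈ Ioo s t, Continuous (U σ)) (hV : ∀ σ ∈ Ioo s t, Continuous (V σ))
    (hliftu : ∀ σ ∈ Ioo s t, Torus.lift (U σ) = u σ) (hliftv : ∀ σ ∈ Ioo s t, Torus.lift (V σ) = v σ) :
    ∫ x, oseenDuhamel ν s u v t (Torus.repr x) = 0 := by
  have h1 : ∀ y, oseenDuhamel ν s u v t y =
      ∫ σ in Ioo s t, oseenSlice (ν * (t - σ)) (u σ) (v σ) y := fun y => rfl
  simp_rw [h1]
  obtain ⟨C₀, hC₀, hS⟩ := exists_norm_oseenSlice_le (E := EuclideanSpace ℝ d)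
  -- Fubini over `𝕋ᵈ × (s, t)`
  have hint : Integrable (uncurry fun (x : UnitAddTorus d) (σ : ℝ) =>
      oseenSlice (ν * (t - σ)) (u σ) (v σ) (Torus.repr x)) (volume.prod (volume.restrict (Ioo s t))) := by
    refine Integrable.mono'
      (g := fun p => (1 : ℝ) * (C₀ * ν ^ (-(1 / 2 : ℝ)) * M * M * (t - p.2) ^ (-(1 / 2 : ℝ))))
      ((integrable_const (1 : ℝ)).mul_prod
        ((integrableOn_Ioo_rpow_neg_half_sub s t).const_mul (C₀ * ν ^ (-(1 / 2 : ℝ)) * M * M)))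
      ?_ ?_
    · have hsm := stronglyMeasurable_oseenSlice_duhamel ν t hum hvm
      exact (hsm.comp_measurable
        (measurable_snd.prodMk (Torus.measurable_repr.comp measurable_fst))).aestronglyMeasurable
    · have hmem : ∀ᵐ p ∂((volume : Measure (UnitAddTorus d)).prod (volume.restrict (Ioo s t))),
          p.2 ∈ Ioo s t := by
        have hre : (volume : Measure (UnitAddTorus d)).prod (volume.restrict (Ioo s t)) =
            ((volume : Measure (UnitAddTorus d)).prod volume).restrict (univ ×ˢ Ioo s t) := by
          rw [← Measure.prod_restrict, Measure.restrict_univ]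
        rw [hre]
        filter_upwards [ae_restrict_mem (MeasurableSet.univ.prod measurableSet_Ioo)] with p hp
        exact (mem_prod.1 hp).2
      filter_upwards [hmem] with p hp
      have hσ : 0 < ν * (t - p.2) := mul_pos hν (sub_pos.2 hp.2)
      calc ‖uncurry (fun (x : UnitAddTorus d) (σ : ℝ) =>
              oseenSlice (ν * (t - σ)) (u σ) (v σ) (Torus.repr x)) p‖
          ≤ C₀ * (ν * (t - p.2)) ^ (-(1 / 2 : ℝ)) * M * M := hS hσ (huM p.2 hp) (hvM p.2 hp) _
        _ = 1 * (C₀ * ν ^ (-(1 / 2 : ℝ)) * M * M * (t - p.2) ^ (-(1 / 2 : ℝ))) := by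
            rw [Real.mul_rpow hν.le (sub_pos.2 hp.2).le]; ring
  rw [integral_integral_swap hint]
  refine (setIntegral_congr_fun measurableSet_Ioo fun σ hσ => ?_).trans (integral_zero _ _)
  rw [← hliftu σ hσ, ← hliftv σ hσ]
  exact integral_oseenSlice_lift_repr_eq_zero (hU σ hσ) (hV σ hσ) (mul_pos hν (sub_pos.2 hσ.2))

/-- **The KNSS constant of a mean-preserving periodic Oseen identity vanishes, and the identity
holds everywhere.** Let `ν, t > 0`; let `U, W` be continuous torus fields with `∫ W = ∫ U`
(conservation of the average; for the application both vanish); let `u` and the pairs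
`(aᵢ, bᵢ)` be bounded jointly measurable fields on `ℝ × ℝᵈ` whose slices on `(0, t)` are lifts of
continuous torus fields; and suppose
`lift W = e^{νtΔ}(lift U) - B^ν_0(u,u)(t) - Σᵢ B^ν_0(aᵢ,bᵢ)(t) - c` a.e. on `ℝᵈ`. Then `c = 0` and
the identity holds at every point (both sides are continuous; integrate over `𝕋ᵈ` along `repr`:
the heat flow preserves the average, the Duhamel terms have average zero, `|𝕋ᵈ| = 1`).
[cite: KochNadirashviliSereginSverak2009, Lemma 3.1 and Rem. 3.1 (arXiv:0709.3599 p. 7)] -/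
theorem oseenMild_const_eq_zero_of_integral_eq {ι : Type*} [Fintype ι]
    {U W : UnitAddTorus d → EuclideanSpace ℝ d}
    {u : ℝ → EuclideanSpace ℝ d → EuclideanSpace ℝ d}
    {Us : ℝ → UnitAddTorus d → EuclideanSpace ℝ d}
    {a b : ι → ℝ → EuclideanSpace ℝ d → EuclideanSpace ℝ d}
    {As Bs : ι → ℝ → UnitAddTorus d → EuclideanSpace ℝ d}
    {ν t M : ℝ} {c : EuclideanSpace ℝ d} (hν : 0 < ν) (ht : 0 < t) (hM : 0 ≤ M)
    (hU : Continuous U) (hW : Continuous W) (hmean : ∫ x, W x = ∫ x, U x)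
    (hum : Measurable (uncurry u)) (huM : ∀ σ y, ‖u σ y‖ ≤ M)
    (hUs : ∀ σ ∈ Ioo 0 t, Continuous (Us σ)) (hliftu : ∀ σ ∈ Ioo 0 t, Torus.lift (Us σ) = u σ)
    (ham : ∀ i, Measurable (uncurry (a i))) (hbm : ∀ i, Measurable (uncurry (b i)))
    (haM : ∀ i σ y, ‖a i σ y‖ ≤ M) (hbM : ∀ i σ y, ‖b i σ y‖ ≤ M)
    (hAs : ∀ i, ∀ σ ∈ Ioo 0 t, Continuous (As i σ)) (hBs : ∀ i, ∀ σ ∈ Ioo 0 t, Continuous (Bs i σ))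
    (hlifta : ∀ i, ∀ σ ∈ Ioo 0 t, Torus.lift (As i σ) = a i σ)
    (hliftb : ∀ i, ∀ σ ∈ Ioo 0 t, Torus.lift (Bs i σ) = b i σ)
    (hUM : ∀ x, ‖U x‖ ≤ M)
    (hae : Torus.lift W =ᵐ[volume] fun y =>
      UnboundedOperators.heatExtension (Torus.lift U) (ν * t) y - oseenDuhamel ν 0 u u t y -
        (∑ i, oseenDuhamel ν 0 (a i) (b i) t y) - c) :
    c = 0 ∧ ∀ y, Torus.lift W y =
      UnboundedOperators.heatExtension (Torus.lift U) (ν * t) y - oseenDuhamel ν 0 u u t y -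
        ∑ i, oseenDuhamel ν 0 (a i) (b i) t y := by
  haveI : CompleteSpace (EuclideanSpace ℝ d) := FiniteDimensional.complete ℝ _
  have hνt : 0 < ν * t := mul_pos hν ht
  -- continuity of both sides ⇒ the identity holds everywhere
  have hliftU : ∀ y, ‖Torus.lift U y‖ ≤ M := fun y => by rw [Torus.lift_apply]; exact hUM _
  have hUm : MemLp (Torus.lift U) ∞ (volume : Measure (EuclideanSpace ℝ d)) :=
    memLp_top_of_bound (Torus.continuous_lift_iff.2 hU).aestronglyMeasurable M
      (Eventually.of_forall hliftU)
  have hh_cont : Continuous (UnboundedOperators.heatExtension (Torus.lift U) (ν * t)) :=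
    (UnboundedOperators.contDiff_heatExtension_holds hUm le_top hνt).continuous
  have hslab : ∀ {w : ℝ → EuclideanSpace ℝ d → EuclideanSpace ℝ d}, Measurable (uncurry w) →
      AEStronglyMeasurable (uncurry w)
        ((volume : Measure (ℝ × EuclideanSpace ℝ d)).restrict (Ioo 0 t ×ˢ univ)) :=
    fun hw => hw.aestronglyMeasurable.restrict
  have hB_cont : Continuous (oseenDuhamel ν 0 u u t) :=
    continuous_oseenDuhamel_slice hν hM (hslab hum) (hslab hum) (fun σ _ y => huM σ y)
      (fun σ _ y => huM σ y) ht le_rfl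
  have hP_cont : ∀ i, Continuous (oseenDuhamel ν 0 (a i) (b i) t) := fun i =>
    continuous_oseenDuhamel_slice hν hM (hslab (ham i)) (hslab (hbm i)) (fun σ _ y => haM i σ y)
      (fun σ _ y => hbM i σ y) ht le_rfl
  have hrhs_cont : Continuous fun y =>
      UnboundedOperators.heatExtension (Torus.lift U) (ν * t) y - oseenDuhamel ν 0 u u t y -
        (∑ i, oseenDuhamel ν 0 (a i) (b i) t y) - c :=
    ((hh_cont.sub hB_cont).sub (continuous_finsetSum _ fun i _ => hP_cont i)).sub continuous_const
  have hlhs_cont : Continuous (Torus.lift W) := Torus.continuous_lift_iff.2 hW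
  have heq : ∀ y, Torus.lift W y =
      UnboundedOperators.heatExtension (Torus.lift U) (ν * t) y - oseenDuhamel ν 0 u u t y -
        (∑ i, oseenDuhamel ν 0 (a i) (b i) t y) - c := by
    have h := (Continuous.ae_eq_iff_eq volume hlhs_cont hrhs_cont).1 hae
    exact fun y => congrFun h y
  -- integrate over the torus along `repr`
  have hI_W : ∫ x, Torus.lift W (Torus.repr x) = ∫ x, W x := by
    simp_rw [Torus.lift_repr]
  have hI_h : ∫ x, UnboundedOperators.heatExtension (Torus.lift U) (ν * t) (Torus.repr x) = ∫ x, U x :=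
    integral_heatExtension_lift_repr hU hνt
  have hI_B : ∫ x, oseenDuhamel ν 0 u u t (Torus.repr x) = 0 :=
    integral_oseenDuhamel_pair_repr_eq_zero hν hum hum (fun σ _ y => huM σ y) (fun σ _ y => huM σ y)
      hUs hUs hliftu hliftu
  have hI_P : ∀ i, ∫ x, oseenDuhamel ν 0 (a i) (b i) t (Torus.repr x) = 0 := fun i =>
    integral_oseenDuhamel_pair_repr_eq_zero hν (ham i) (hbm i) (fun σ _ y => haM i σ y)
      (fun σ _ y => hbM i σ y) (hAs i) (hBs i) (hlifta i) (hliftb i)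
  -- integrability on the compact torus (continuous functions)
  have hcomp : ∀ {g : EuclideanSpace ℝ d → EuclideanSpace ℝ d}, Continuous g →
      Integrable (fun x : UnitAddTorus d => g (Torus.repr x)) := by
    intro g hg
    obtain ⟨C, hC⟩ : ∃ C, ∀ x : UnitAddTorus d, ‖g (Torus.repr x)‖ ≤ C := by
      -- `repr` takes values in the unit cube, a bounded set
      have hcube : ∀ x : UnitAddTorus d, ‖Torus.repr x‖ ≤ Real.sqrt (Fintype.card d) := by
        intro x
        have hm := Torus.repr_mem_unitCube x
        rw [EuclideanSpace.norm_eq]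
        refine Real.sqrt_le_sqrt ?_
        calc ∑ i, ‖Torus.repr x i‖ ^ 2 ≤ ∑ _i : d, (1 : ℝ) := Finset.sum_le_sum fun i _ => by
                have hi := (Torus.mem_unitCube.1 hm) i
                rw [Real.norm_eq_abs, abs_of_nonneg hi.1]
                nlinarith [hi.1, hi.2]
          _ = Fintype.card d := by simp
      obtain ⟨C, hC⟩ := (isCompact_closedBall (0 : EuclideanSpace ℝ d)
        (Real.sqrt (Fintype.card d))).exists_bound_of_continuousOn hg.continuousOn
      exact ⟨C, fun x => hC _ (mem_closedBall_zero_iff.2 (hcube x))⟩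
    exact (integrable_const C).mono' (hg.measurable.comp Torus.measurable_repr).aestronglyMeasurable
      (Eventually.of_forall hC)
  have iW : Integrable (fun x : UnitAddTorus d => Torus.lift W (Torus.repr x)) := hcomp hlhs_cont
  have ih : Integrable (fun x : UnitAddTorus d =>
      UnboundedOperators.heatExtension (Torus.lift U) (ν * t) (Torus.repr x)) := hcomp hh_cont
  have iB : Integrable (fun x : UnitAddTorus d => oseenDuhamel ν 0 u u t (Torus.repr x)) := hcomp hB_cont
  have iP : ∀ i, Integrable (fun x : UnitAddTorus d => oseenDuhamel ν 0 (a i) (b i) t (Torus.repr x)) :=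
    fun i => hcomp (hP_cont i)
  have iS : Integrable (fun x : UnitAddTorus d => ∑ i, oseenDuhamel ν 0 (a i) (b i) t (Torus.repr x)) :=
    integrable_finsetSum _ fun i _ => iP i
  have hI_S : ∫ x : UnitAddTorus d, ∑ i, oseenDuhamel ν 0 (a i) (b i) t (Torus.repr x) = 0 := by
    rw [integral_finsetSum _ fun i _ => iP i]
    exact Finset.sum_eq_zero fun i _ => hI_P i
  have hkey' : ∫ x : UnitAddTorus d, Torus.lift W (Torus.repr x) =
      (∫ x : UnitAddTorus d, UnboundedOperators.heatExtension (Torus.lift U) (ν * t) (Torus.repr x)) -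
        (∫ x : UnitAddTorus d, oseenDuhamel ν 0 u u t (Torus.repr x)) -
        (∫ x : UnitAddTorus d, ∑ i, oseenDuhamel ν 0 (a i) (b i) t (Torus.repr x)) - c := by
    have e : (fun x : UnitAddTorus d => Torus.lift W (Torus.repr x)) = fun x =>
        UnboundedOperators.heatExtension (Torus.lift U) (ν * t) (Torus.repr x) -
          oseenDuhamel ν 0 u u t (Torus.repr x) -
          (∑ i, oseenDuhamel ν 0 (a i) (b i) t (Torus.repr x)) - c := funext fun x => heq _
    have i1 : Integrable (fun x : UnitAddTorus d =>
        UnboundedOperators.heatExtension (Torus.lift U) (ν * t) (Torus.repr x) -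
          oseenDuhamel ν 0 u u t (Torus.repr x)) := ih.sub iB
    have i2 : Integrable (fun x : UnitAddTorus d =>
        UnboundedOperators.heatExtension (Torus.lift U) (ν * t) (Torus.repr x) -
          oseenDuhamel ν 0 u u t (Torus.repr x) -
          ∑ i, oseenDuhamel ν 0 (a i) (b i) t (Torus.repr x)) := i1.sub iS
    have i3 : Integrable (fun _ : UnitAddTorus d => c) := integrable_const c
    rw [e, integral_sub i2 i3, integral_sub i1 iS, integral_sub ih iB, integral_const]
    simp
  have hkey : ∫ x, W x = (∫ x, U x) - c := by
    rw [← hI_W, hkey', hI_h, hI_B, hI_S, sub_zero, sub_zero]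
  have hc : c = 0 := by
    rw [hmean, eq_comm, sub_eq_self] at hkey
    exact hkey
  refine ⟨hc, fun y => ?_⟩
  rw [heq y, hc, sub_zero]

end Torus

end Literature.Analysis.FluidPDE
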